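import Mathlib
import Literature.NumberTheory.LFunctions.TaoLogChowlaMoebiusOfLiouville
import Literature.NumberTheory.LFunctions.ZetaPowCoeffShortInterval
import Summits.Parity.GeneralizedHardyLittlewood.Theorems.LiouvilleShiftedTablesMAvgSquarefree

/-!
# Crux `EngineToGHL` (stmt-Parity-14995, route LiouvilleMAD), line `tuple_ladder`,
# stub `stub_rungLarge` — auxiliary file: the fixed-`N` inequality

The rung of the tuple ladder opens `Λ(n + hs) = -∑_{d ∣ n+hs} μ(d) log d` against a weight `F(n)`
(in the application `F(n) = ∏_{h ∈ H'} Λ(n+h)`) and splits the divisors of `m = n + hs` at `D`.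
This file treats the LARGE divisors `d > D` for a fixed `N` and an arbitrary `F : ℕ → ℝ`:
the opening `d ↦ e = m/d ≤ E := (N+hs)/(D+1)`, `μ(m/e) = λ(e) λ(m) ∑_{k² e ∣ m} μ(k)`
(squarefree sieve `μ = λ · 𝟙_sf`, `𝟙_sf = ∑_{k² ∣ ·} μ` from the tree's
`moebius_eq_liouville_mul_sqfreeInd` / `sqfreeInd_eq_sum_moebius`) and the exchange
`∑_{n ≤ N} F(n) ∑_{d ∣ m, d > D} μ(d) log d = ∑_{e ≤ E} ∑_{k ≤ N+hs} λ(e) μ(k) T(e,k)`,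
`T(e,k) = ∑_{n ≤ N, k²e ∣ m, m/e > D} λ(m) F(n) log(m/e)`; Abel summation
(`|T(e,k)| ≤ 2 M_{k²e} log(N+hs)` when the partial sums `|∑_{n ≤ y, q ∣ n+hs} λ(n+hs) F(n)|` are
`≤ M_q`); the trivial bound `|T(e,k)| ≤ B log(N+hs) (N+hs)/(k²e)` for `|F| ≤ B`; and the master
inequality `abs_sum_mul_sum_divisors_filter_le`: for every cut-off `K` with `K² E ≤ Q`,
`|∑_{n ≤ N} F(n) ∑_{d ∣ m, d > D} μ(d) log d| ≤ 2 log(N+hs) K ∑_{q ≤ Q} M_q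
  + B log(N+hs) (N+hs) (1 + log E) · 2/(K+1)`.
The asymptotic bookkeeping is in `LiouvilleMADEngineToGHLStubRungLarge.lean`.  Elementary. [folklore]
-/

noncomputable section

open Finset Real ArithmeticFunction Filter
open scoped ArithmeticFunction.Moebius

namespace Summit.Parity.GeneralizedHardyLittlewood.Theorems.EngineToGHL.TupleLadder

open Literature.NumberTheory.LFunctions (moebius_eq_liouville_mul_sqfreeInd sqfreeInd_eq_sum_moebius
  abs_moebius_real_le_one)
open Literature.NumberTheory.LFunctions.LiouvilleSum (abs_liouville_le_one sum_Ioc_inv_le_one_add_log)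
open Literature.NumberTheory.LFunctions.SelbergDelange.DivisorBounds (log_natCast_mono)

/-- Abel summation identity on `[1, N]`: with `P(y) = ∑_{1 ≤ j ≤ y} c(j)`,
`∑_{1 ≤ i ≤ N} f(i) c(i) = f(N) P(N) - ∑_{i < N} (f(i+1) - f(i)) P(i)`. [folklore] -/
theorem sum_Icc_mul_eq_sub_sum_range (f c : ℕ → ℝ) (N : ℕ) :
    ∑ i ∈ Icc 1 N, f i * c i
      = f N * ∑ i ∈ Icc 1 N, c i - ∑ i ∈ range N, (f (i + 1) - f i) * ∑ j ∈ Icc 1 i, c j := by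
  induction N with
  | zero => simp
  | succ N ih =>
      rw [Finset.sum_Icc_succ_top (Nat.succ_le_succ (Nat.zero_le N)), ih,
        Finset.sum_Icc_succ_top (Nat.succ_le_succ (Nat.zero_le N)), Finset.sum_range_succ]
      ring

/-- **Abel summation bound.** If `f` is monotone with `f(0) ≥ 0` and all partial sums
`|∑_{1 ≤ i ≤ y} c(i)|`, `y ≤ N`, are at most `M`, then `|∑_{1 ≤ i ≤ N} f(i) c(i)| ≤ 2 M f(N)`.
[folklore] -/
theorem abs_sum_Icc_mul_le_of_monotone {f c : ℕ → ℝ} {N : ℕ} {M : ℝ} (hf : Monotone f)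
    (hf0 : 0 ≤ f 0) (hM : ∀ y ≤ N, |∑ i ∈ Icc 1 y, c i| ≤ M) :
    |∑ i ∈ Icc 1 N, f i * c i| ≤ 2 * M * f N := by
  have hfN : 0 ≤ f N := hf0.trans (hf (Nat.zero_le N))
  rw [sum_Icc_mul_eq_sub_sum_range]
  have h1 : |f N * ∑ i ∈ Icc 1 N, c i| ≤ f N * M := by
    rw [abs_mul, abs_of_nonneg hfN]
    exact mul_le_mul_of_nonneg_left (hM N le_rfl) hfN
  have h2 : |∑ i ∈ range N, (f (i + 1) - f i) * ∑ j ∈ Icc 1 i, c j| ≤ f N * M := by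
    calc |∑ i ∈ range N, (f (i + 1) - f i) * ∑ j ∈ Icc 1 i, c j|
        ≤ ∑ i ∈ range N, |(f (i + 1) - f i) * ∑ j ∈ Icc 1 i, c j| := abs_sum_le_sum_abs _ _
      _ ≤ ∑ i ∈ range N, (f (i + 1) - f i) * M := by
          refine sum_le_sum fun i hi => ?_
          rw [mem_range] at hi
          rw [abs_mul, abs_of_nonneg (sub_nonneg.mpr (hf (Nat.le_succ i)))]
          exact mul_le_mul_of_nonneg_left (hM i hi.le) (sub_nonneg.mpr (hf (Nat.le_succ i)))
      _ = (f N - f 0) * M := by rw [← sum_mul, sum_range_sub]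
      _ ≤ f N * M := by
          have hM0 : 0 ≤ M := le_trans (abs_nonneg _) (hM 0 (Nat.zero_le _))
          nlinarith
  refine (abs_sub _ _).trans ?_
  linarith [h1, h2]

/-- The multiples of `q ≥ 1` among the `n + hs`, `1 ≤ n ≤ N`, number at most `(N + hs)/q`
(`n ↦ (n + hs)/q` is injective into `[1, (N+hs)/q]`). [folklore] -/
theorem card_filter_dvd_add_le {q : ℕ} (hq : 0 < q) (N hs : ℕ) :
    (((Icc 1 N).filter (fun n => q ∣ n + hs)).card : ℝ) ≤ ((N + hs : ℕ) : ℝ) / q := by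
  have h : ((Icc 1 N).filter (fun n => q ∣ n + hs)).card ≤ (Icc 1 ((N + hs) / q)).card := by
    refine Finset.card_le_card_of_injOn (fun n => (n + hs) / q) ?_ ?_
    · intro n hn
      have hn' := Finset.mem_coe.mp hn
      rw [mem_filter, mem_Icc] at hn'
      rw [mem_coe, mem_Icc]
      exact ⟨Nat.div_pos (Nat.le_of_dvd (by omega) hn'.2) hq, Nat.div_le_div_right (by omega)⟩
    · intro a ha b hb hab
      have ha' := (mem_filter.mp (Finset.mem_coe.mp ha)).2
      have hb' := (mem_filter.mp (Finset.mem_coe.mp hb)).2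
      have hab' : (a + hs) / q = (b + hs) / q := hab
      have key : a + hs = b + hs := by
        rw [← Nat.div_mul_cancel ha', ← Nat.div_mul_cancel hb', hab']
      omega
  rw [Nat.card_Icc, Nat.add_sub_cancel] at h
  calc (((Icc 1 N).filter (fun n => q ∣ n + hs)).card : ℝ) ≤ (((N + hs) / q : ℕ) : ℝ) := by
        exact_mod_cast h
    _ ≤ ((N + hs : ℕ) : ℝ) / q := Nat.cast_div_le

/-- `μ(m/e) = λ(e) λ(m) ∑_{k ≤ K', k² e ∣ m} μ(k)` for `e ∣ m`, `0 < m ≤ K'`: the squarefree sieve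
`μ = λ · 𝟙_sf`, `𝟙_sf(m/e) = ∑_{k² ∣ m/e} μ(k)`, and `λ(m) = λ(e) λ(m/e)`, `λ(e)² = 1`. [folklore] -/
theorem moebius_div_eq {m e K' : ℕ} (hm : 0 < m) (he : e ∣ m) (hK : m ≤ K') :
    (μ (m / e) : ℝ) = (liouville e : ℝ) * (liouville m : ℝ) *
      ∑ k ∈ (Icc 1 K').filter (fun k => k ^ 2 * e ∣ m), (μ k : ℝ) := by
  have he0 : 0 < e := Nat.pos_of_dvd_of_pos he hm
  have hme : 0 < m / e := Nat.div_pos (Nat.le_of_dvd hm he) he0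
  have hmeK : m / e ≤ K' := (Nat.div_le_self m e).trans hK
  rw [moebius_eq_liouville_mul_sqfreeInd, sqfreeInd_eq_sum_moebius hme hmeK]
  have hfilter : (Icc 1 K').filter (fun k => k ^ 2 ∣ m / e)
      = (Icc 1 K').filter (fun k => k ^ 2 * e ∣ m) := by
    refine Finset.filter_congr fun k _ => ?_
    rw [Nat.dvd_div_iff_mul_dvd he, mul_comm]
  have hsq : liouville e * liouville e = 1 := by
    rw [liouville_apply he0.ne', ← pow_add, ← two_mul, pow_mul, neg_one_sq, one_pow]
  have hlamZ : liouville (m / e) = liouville e * liouville m := by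
    have h1 : liouville m = liouville e * liouville (m / e) := by
      rw [← liouville_apply_mul, Nat.mul_div_cancel' he]
    rw [h1, ← mul_assoc, hsq, one_mul]
  rw [hfilter, hlamZ]
  push_cast
  ring

/-- Opening of the large divisors of `0 < m ≤ K'` with `m/(D+1) ≤ E`: reindexing `d ↦ e = m/d`
(`Nat.sum_div_divisors`) and `moebius_div_eq` give, for every constant `a`,
`a · ∑_{d ∣ m, D < d} μ(d) log d = ∑_{e ≤ E} ∑_{k ≤ K'} λ(e) μ(k) · [k² e ∣ m] [D < m/e] λ(m) a log(m/e)`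
(divisors `e > E` have `m/e ≤ D`; non-divisors contribute nothing). [folklore] -/
theorem mul_sum_divisors_filter_eq (a : ℝ) {m D E K' : ℕ} (hm : 0 < m) (hK : m ≤ K')
    (hE : m / (D + 1) ≤ E) :
    a * ∑ d ∈ m.divisors.filter (fun d => D < d), (μ d : ℝ) * Real.log d
      = ∑ e ∈ Icc 1 E, ∑ k ∈ Icc 1 K', (liouville e : ℝ) * (μ k : ℝ) *
          (if k ^ 2 * e ∣ m then
            (if D < m / e then (liouville m : ℝ) * a * Real.log ((m / e : ℕ) : ℝ) else 0) else 0) := by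
  set G : ℕ → ℝ := fun e => ∑ k ∈ Icc 1 K', (liouville e : ℝ) * (μ k : ℝ) *
      (if k ^ 2 * e ∣ m then
        (if D < m / e then (liouville m : ℝ) * a * Real.log ((m / e : ℕ) : ℝ) else 0) else 0) with hG
  -- Step 1: reindex `d ↦ m / e`.
  have h1 : a * ∑ d ∈ m.divisors.filter (fun d => D < d), (μ d : ℝ) * Real.log d
      = ∑ e ∈ m.divisors,
          a * (if D < m / e then (μ (m / e) : ℝ) * Real.log ((m / e : ℕ) : ℝ) else 0) := by
    rw [Finset.sum_filter,
      ← Nat.sum_div_divisors m (fun d => if D < d then (μ d : ℝ) * Real.log d else 0),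
      Finset.mul_sum]
  -- Step 2: on the divisors the summand is `G e`.
  have h2 : ∀ e ∈ m.divisors,
      a * (if D < m / e then (μ (m / e) : ℝ) * Real.log ((m / e : ℕ) : ℝ) else 0) = G e := by
    intro e he
    rw [Nat.mem_divisors] at he
    by_cases hD : D < m / e
    · rw [if_pos hD, moebius_div_eq hm he.1 hK]
      simp only [hG, if_pos hD, Finset.sum_filter, Finset.mul_sum, Finset.sum_mul]
      refine Finset.sum_congr rfl fun k _ => ?_
      split_ifs <;> ring
    · simp [hG, hD]
  -- Step 3: `G` vanishes off the divisors and above `E`.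
  have h3 : ∀ e, ¬ e ∣ m → G e = 0 := by
    intro e he
    refine Finset.sum_eq_zero fun k _ => ?_
    rw [if_neg (fun h => he ((dvd_mul_left e (k ^ 2)).trans h)), mul_zero]
  have h4 : ∀ e, E < e → G e = 0 := by
    intro e he
    have h' : m / (D + 1) < e := lt_of_le_of_lt hE he
    rw [Nat.div_lt_iff_lt_mul (Nat.succ_pos D)] at h'
    have h'' : m / e < D + 1 := by
      rw [Nat.div_lt_iff_lt_mul (by omega), mul_comm]
      exact h'
    have hDe : ¬ D < m / e := by omega
    simp [hG, hDe]
  calc a * ∑ d ∈ m.divisors.filter (fun d => D < d), (μ d : ℝ) * Real.log d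
      = ∑ e ∈ m.divisors, G e := by rw [h1]; exact Finset.sum_congr rfl h2
    _ = ∑ e ∈ m.divisors ∩ Icc 1 E, G e := by
        symm
        refine Finset.sum_subset Finset.inter_subset_left fun e he hne => h4 e ?_
        rw [Finset.mem_inter, not_and, mem_Icc] at hne
        have := hne he
        have he1 : 1 ≤ e := Nat.pos_of_mem_divisors he
        omega
    _ = ∑ e ∈ Icc 1 E, G e := by
        refine Finset.sum_subset Finset.inter_subset_right fun e he hne => h3 e fun hdvd => hne ?_
        rw [Finset.mem_inter]
        exact ⟨Nat.mem_divisors.mpr ⟨hdvd, hm.ne'⟩, he⟩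

/-- **The opened and exchanged large-divisor sum.** With `E = (N+hs)/(D+1)` and `K' = N + hs`:
`∑_{n ≤ N} F(n) ∑_{d ∣ n+hs, D < d} μ(d) log d = ∑_{e ≤ E} ∑_{k ≤ K'} λ(e) μ(k) T(e,k)`,
`T(e,k) = ∑_{n ≤ N} [k² e ∣ n+hs] [D < (n+hs)/e] λ(n+hs) F(n) log((n+hs)/e)`. [folklore] -/
theorem sum_mul_sum_divisors_filter_eq (F : ℕ → ℝ) (N hs D : ℕ) :
    ∑ n ∈ Icc 1 N, F n * ∑ d ∈ (n + hs).divisors.filter (fun d => D < d), (μ d : ℝ) * Real.log d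
      = ∑ e ∈ Icc 1 ((N + hs) / (D + 1)), ∑ k ∈ Icc 1 (N + hs), (liouville e : ℝ) * (μ k : ℝ) *
          ∑ n ∈ Icc 1 N, (if k ^ 2 * e ∣ n + hs then
            (if D < (n + hs) / e then
              (liouville (n + hs) : ℝ) * F n * Real.log (((n + hs) / e : ℕ) : ℝ) else 0) else 0) := by
  have h1 : ∀ n ∈ Icc 1 N,
      F n * ∑ d ∈ (n + hs).divisors.filter (fun d => D < d), (μ d : ℝ) * Real.log d
      = ∑ e ∈ Icc 1 ((N + hs) / (D + 1)), ∑ k ∈ Icc 1 (N + hs), (liouville e : ℝ) * (μ k : ℝ) *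
          (if k ^ 2 * e ∣ n + hs then
            (if D < (n + hs) / e then
              (liouville (n + hs) : ℝ) * F n * Real.log (((n + hs) / e : ℕ) : ℝ) else 0) else 0) := by
    intro n hn
    rw [mem_Icc] at hn
    exact mul_sum_divisors_filter_eq (F n) (by omega) (Nat.add_le_add_right hn.2 hs)
      (Nat.div_le_div_right (Nat.add_le_add_right hn.2 hs))
  rw [Finset.sum_congr rfl h1, Finset.sum_comm]
  refine Finset.sum_congr rfl fun e _ => ?_
  rw [Finset.sum_comm]
  refine Finset.sum_congr rfl fun k _ => ?_
  rw [Finset.mul_sum]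

/-- Partial summation in the main range: if `|∑_{n ≤ y, q ∣ n+hs} λ(n+hs) F(n)| ≤ M` for all
`y ≤ N`, then `|∑_{n ≤ N} [q ∣ n+hs] [D < (n+hs)/e] λ(n+hs) F(n) log((n+hs)/e)| ≤ 2 M log(N+hs)`
(the weight `[D < (n+hs)/e] log((n+hs)/e)` is non-negative and non-decreasing in `n`). [folklore] -/
theorem abs_inner_le_of_partial_sums (F : ℕ → ℝ) {N hs D e q : ℕ} {M : ℝ}
    (hM : ∀ y ≤ N,
      |∑ n ∈ (Icc 1 y).filter (fun n => q ∣ n + hs), (liouville (n + hs) : ℝ) * F n| ≤ M) :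
    |∑ n ∈ Icc 1 N, (if q ∣ n + hs then
        (if D < (n + hs) / e then
          (liouville (n + hs) : ℝ) * F n * Real.log (((n + hs) / e : ℕ) : ℝ) else 0) else 0)|
      ≤ 2 * M * Real.log ((N + hs : ℕ) : ℝ) := by
  set f : ℕ → ℝ := fun n => if D < (n + hs) / e then Real.log (((n + hs) / e : ℕ) : ℝ) else 0
    with hf
  set c : ℕ → ℝ := fun n => if q ∣ n + hs then (liouville (n + hs) : ℝ) * F n else 0 with hc
  have hM0 : 0 ≤ M := le_trans (abs_nonneg _) (hM 0 (Nat.zero_le _))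
  have hfc : ∀ n, (if q ∣ n + hs then
        (if D < (n + hs) / e then
          (liouville (n + hs) : ℝ) * F n * Real.log (((n + hs) / e : ℕ) : ℝ) else 0) else 0)
      = f n * c n := by
    intro n
    simp only [hf, hc]
    split_ifs <;> ring
  have hfnn : ∀ n, 0 ≤ f n := fun n => by
    simp only [hf]
    split_ifs
    exacts [Real.log_natCast_nonneg _, le_rfl]
  have hmono : Monotone f := by
    intro a b hab
    have hdiv : (a + hs) / e ≤ (b + hs) / e := Nat.div_le_div_right (by omega)
    by_cases ha : D < (a + hs) / e
    · simp only [hf, if_pos ha, if_pos (lt_of_lt_of_le ha hdiv)]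
      exact log_natCast_mono hdiv
    · have hb := hfnn b
      simp only [hf, if_neg ha] at hb ⊢
      exact hb
  have hPc : ∀ y ≤ N, |∑ i ∈ Icc 1 y, c i| ≤ M := by
    intro y hy
    simp only [hc]
    rw [← Finset.sum_filter]
    exact hM y hy
  have hfN : f N ≤ Real.log ((N + hs : ℕ) : ℝ) := by
    simp only [hf]
    split_ifs
    exacts [log_natCast_mono (Nat.div_le_self _ _), Real.log_natCast_nonneg _]
  rw [Finset.sum_congr rfl fun n _ => hfc n]
  calc |∑ n ∈ Icc 1 N, f n * c n| ≤ 2 * M * f N :=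
        abs_sum_Icc_mul_le_of_monotone hmono (hfnn 0) hPc
    _ ≤ 2 * M * Real.log ((N + hs : ℕ) : ℝ) := mul_le_mul_of_nonneg_left hfN (by positivity)

/-- Trivial bound: if `|F(n)| ≤ B` on `[1, N]` and `q ≥ 1`, then
`|∑_{n ≤ N} [q ∣ n+hs] [D < (n+hs)/e] λ(n+hs) F(n) log((n+hs)/e)| ≤ B log(N+hs) (N+hs)/q`
(`|λ| ≤ 1`, `0 ≤ log((n+hs)/e) ≤ log(N+hs)`, and `card_filter_dvd_add_le`). [folklore] -/
theorem abs_inner_le_trivial (F : ℕ → ℝ) {N hs D e q : ℕ} (hq : 0 < q) {B : ℝ} (hB : 0 ≤ B)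
    (hF : ∀ n ∈ Icc 1 N, |F n| ≤ B) :
    |∑ n ∈ Icc 1 N, (if q ∣ n + hs then
        (if D < (n + hs) / e then
          (liouville (n + hs) : ℝ) * F n * Real.log (((n + hs) / e : ℕ) : ℝ) else 0) else 0)|
      ≤ B * Real.log ((N + hs : ℕ) : ℝ) * ((N + hs : ℕ) : ℝ) / q := by
  have hlog0 : 0 ≤ Real.log ((N + hs : ℕ) : ℝ) := Real.log_natCast_nonneg _
  rw [← Finset.sum_filter]
  calc |∑ n ∈ (Icc 1 N).filter (fun n => q ∣ n + hs), (if D < (n + hs) / e then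
          (liouville (n + hs) : ℝ) * F n * Real.log (((n + hs) / e : ℕ) : ℝ) else 0)|
      ≤ ∑ n ∈ (Icc 1 N).filter (fun n => q ∣ n + hs), B * Real.log ((N + hs : ℕ) : ℝ) := by
        refine (abs_sum_le_sum_abs _ _).trans (sum_le_sum fun n hn => ?_)
        rw [mem_filter, mem_Icc] at hn
        split_ifs
        · rw [abs_mul, abs_mul]
          have h1 : |(liouville (n + hs) : ℝ)| ≤ 1 := abs_liouville_le_one _
          have h2 : |F n| ≤ B := hF n (mem_Icc.mpr hn.1)
          have h3 : |Real.log (((n + hs) / e : ℕ) : ℝ)| ≤ Real.log ((N + hs : ℕ) : ℝ) := by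
            rw [abs_of_nonneg (Real.log_natCast_nonneg _)]
            exact log_natCast_mono ((Nat.div_le_self _ _).trans (by omega))
          calc |(liouville (n + hs) : ℝ)| * |F n| * |Real.log (((n + hs) / e : ℕ) : ℝ)|
              ≤ 1 * B * Real.log ((N + hs : ℕ) : ℝ) :=
                mul_le_mul (mul_le_mul h1 h2 (abs_nonneg _) zero_le_one) h3 (abs_nonneg _)
                  (by positivity)
            _ = B * Real.log ((N + hs : ℕ) : ℝ) := by ring
        · rw [abs_zero]
          positivity
    _ = (((Icc 1 N).filter (fun n => q ∣ n + hs)).card : ℝ) * (B * Real.log ((N + hs : ℕ) : ℝ)) := by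
        rw [sum_const, nsmul_eq_mul]
    _ ≤ ((N + hs : ℕ) : ℝ) / q * (B * Real.log ((N + hs : ℕ) : ℝ)) :=
        mul_le_mul_of_nonneg_right (card_filter_dvd_add_le hq N hs) (by positivity)
    _ = B * Real.log ((N + hs : ℕ) : ℝ) * ((N + hs : ℕ) : ℝ) / q := by ring

/-- **Master inequality for the large divisors (fixed `N`)** (registered sub-goal of the stub
`stub_rungLarge`, stated in `∀`-form).  Let `|F| ≤ B` on `[1, N]`, let
`M_q` bound all the partial sums `|∑_{n ≤ y, q ∣ n+hs} λ(n+hs) F(n)|`, `y ≤ N`, and let the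
cut-off `K` satisfy `K² E ≤ Q`, `E = (N+hs)/(D+1)`.  Then
`|∑_{n ≤ N} F(n) ∑_{d ∣ n+hs, D < d} μ(d) log d|
   ≤ 2 log(N+hs) · K · ∑_{q ≤ Q} M_q + B log(N+hs) (N+hs) (1 + log E) · 2/(K+1)`. [folklore] -/
theorem abs_sum_mul_sum_divisors_filter_le : ∀ (F : ℕ → ℝ) (N hs D K Q : ℕ) (B : ℝ) (M : ℕ → ℝ), 0 ≤ B → (∀ n ∈ Finset.Icc 1 N, |F n| ≤ B) → (∀ q y : ℕ, y ≤ N → |∑ n ∈ (Finset.Icc 1 y).filter (fun n : ℕ => q ∣ n + hs), (ArithmeticFunction.liouville (n + hs) : ℝ) * F n| ≤ M q) → K ^ 2 * ((N + hs) / (D + 1)) ≤ Q → |∑ n ∈ Finset.Icc 1 N, F n * ∑ d ∈ (n + hs).divisors.filter (fun d : ℕ => D < d), (ArithmeticFunction.moebius d : ℝ) * Real.log d| ≤ 2 * Real.log ((N + hs : ℕ) : ℝ) * K * ∑ q ∈ Finset.Icc 1 Q, M q + B * Real.log ((N + hs : ℕ) : ℝ) * ((N + hs : ℕ) : ℝ)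 * (1 + Real.log (((N + hs) / (D + 1) : ℕ) : ℝ)) * (2 / ((K : ℝ) + 1)) := by
  intro F N hs D K Q B M hB hF hM hKQ
  set E : ℕ := (N + hs) / (D + 1) with hE
  set L : ℝ := Real.log ((N + hs : ℕ) : ℝ) with hL
  set T : ℕ → ℕ → ℝ := fun e k => ∑ n ∈ Icc 1 N, (if k ^ 2 * e ∣ n + hs then
      (if D < (n + hs) / e then
        (liouville (n + hs) : ℝ) * F n * Real.log (((n + hs) / e : ℕ) : ℝ) else 0) else 0) with hT
  have hM0 : ∀ q, 0 ≤ M q := fun q => le_trans (abs_nonneg _) (hM q 0 (Nat.zero_le _))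
  have hL0 : 0 ≤ L := Real.log_natCast_nonneg _
  -- Step 1: triangle inequality with `|λ(e)| ≤ 1`, `|μ(k)| ≤ 1`.
  have h1 : |∑ e ∈ Icc 1 E, ∑ k ∈ Icc 1 (N + hs), (liouville e : ℝ) * (μ k : ℝ) * T e k|
      ≤ ∑ e ∈ Icc 1 E, ∑ k ∈ Icc 1 (N + hs), |T e k| := by
    refine (abs_sum_le_sum_abs _ _).trans (sum_le_sum fun e _ =>
      (abs_sum_le_sum_abs _ _).trans (sum_le_sum fun k _ => ?_))
    rw [abs_mul, abs_mul]
    calc |(liouville e : ℝ)| * |(μ k : ℝ)| * |T e k| ≤ 1 * 1 * |T e k| :=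
          mul_le_mul_of_nonneg_right (mul_le_mul (abs_liouville_le_one e)
            (abs_moebius_real_le_one k) (abs_nonneg _) zero_le_one) (abs_nonneg _)
      _ = |T e k| := by ring
  -- Step 2: split the `k`-range at `K`.
  have h2 : ∀ e, ∑ k ∈ Icc 1 (N + hs), |T e k|
      ≤ ∑ k ∈ Icc 1 K, |T e k| + ∑ k ∈ Ioc K (N + hs), |T e k| := by
    intro e
    rw [← Finset.sum_union (by
      rw [Finset.disjoint_left]; intro k hk1 hk2; rw [mem_Icc] at hk1; rw [mem_Ioc] at hk2; omega)]
    refine Finset.sum_le_sum_of_subset_of_nonneg (fun k hk => ?_) (fun _ _ _ => abs_nonneg _)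
    rw [mem_Icc] at hk
    rw [mem_union, mem_Icc, mem_Ioc]
    omega
  -- Step 3: the main range `k ≤ K` by partial summation and the dilations `e ↦ k² e`.
  have h3 : ∑ e ∈ Icc 1 E, ∑ k ∈ Icc 1 K, |T e k| ≤ 2 * L * K * ∑ q ∈ Icc 1 Q, M q := by
    calc ∑ e ∈ Icc 1 E, ∑ k ∈ Icc 1 K, |T e k|
        ≤ ∑ e ∈ Icc 1 E, ∑ k ∈ Icc 1 K, 2 * M (k ^ 2 * e) * L :=
          sum_le_sum fun e _ => sum_le_sum fun k _ =>
            abs_inner_le_of_partial_sums F (hM (k ^ 2 * e))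
      _ = 2 * L * ∑ k ∈ Icc 1 K, ∑ e ∈ Icc 1 E, M (k ^ 2 * e) := by
          rw [Finset.sum_comm, Finset.mul_sum]
          refine sum_congr rfl fun k _ => ?_
          rw [Finset.mul_sum]
          refine sum_congr rfl fun e _ => ?_
          ring
      _ ≤ 2 * L * ∑ k ∈ Icc 1 K, ∑ q ∈ Icc 1 Q, M q := by
          apply mul_le_mul_of_nonneg_left _ (by positivity)
          refine sum_le_sum fun k hk => ?_
          rw [mem_Icc] at hk
          exact MAvg.sum_Icc_comp_sq_mul_le hk.1 hk.2 hKQ M hM0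
      _ = 2 * L * K * ∑ q ∈ Icc 1 Q, M q := by
          rw [sum_const, Nat.card_Icc, Nat.add_sub_cancel, nsmul_eq_mul]
          ring
  -- Step 4: the tail `k > K`, trivially.
  have h4 : ∑ e ∈ Icc 1 E, ∑ k ∈ Ioc K (N + hs), |T e k|
      ≤ B * L * ((N + hs : ℕ) : ℝ) * (1 + Real.log (E : ℝ)) * (2 / ((K : ℝ) + 1)) := by
    calc ∑ e ∈ Icc 1 E, ∑ k ∈ Ioc K (N + hs), |T e k|
        ≤ ∑ e ∈ Icc 1 E, ∑ k ∈ Ioc K (N + hs),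
            B * L * ((N + hs : ℕ) : ℝ) * ((e : ℝ)⁻¹ * ((k : ℝ) ^ 2)⁻¹) := by
          refine sum_le_sum fun e he => sum_le_sum fun k hk => ?_
          rw [mem_Icc] at he
          rw [mem_Ioc] at hk
          have hk0 : k ≠ 0 := by omega
          have he0 : e ≠ 0 := by omega
          have hq : 0 < k ^ 2 * e := Nat.pos_of_ne_zero (Nat.mul_ne_zero (pow_ne_zero 2 hk0) he0)
          calc |T e k| ≤ B * L * ((N + hs : ℕ) : ℝ) / (k ^ 2 * e : ℕ) :=
                abs_inner_le_trivial F hq hB hF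
            _ = B * L * ((N + hs : ℕ) : ℝ) * ((e : ℝ)⁻¹ * ((k : ℝ) ^ 2)⁻¹) := by
                have hk0' : (k : ℝ) ≠ 0 := by exact_mod_cast hk0
                have he0' : (e : ℝ) ≠ 0 := by exact_mod_cast he0
                push_cast
                field_simp
      _ = B * L * ((N + hs : ℕ) : ℝ) *
            ((∑ e ∈ Icc 1 E, (e : ℝ)⁻¹) * ∑ k ∈ Ioc K (N + hs), ((k : ℝ) ^ 2)⁻¹) := by
          rw [Finset.sum_mul_sum, Finset.mul_sum]
          refine sum_congr rfl fun e _ => ?_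
          rw [Finset.mul_sum]
      _ ≤ B * L * ((N + hs : ℕ) : ℝ) * ((1 + Real.log (E : ℝ)) * (2 / ((K : ℝ) + 1))) := by
          apply mul_le_mul_of_nonneg_left _ (by positivity)
          refine mul_le_mul ?_ (MAvg.sum_Ioc_inv_sq_le_two_div K (N + hs))
            (sum_nonneg fun _ _ => by positivity) ?_
          · rw [show Icc 1 E = Ioc 0 E from Finset.Icc_add_one_left_eq_Ioc 0 E]
            exact sum_Ioc_inv_le_one_add_log E
          · have := Real.log_natCast_nonneg E
            linarith
      _ = B * L * ((N + hs : ℕ) : ℝ) * (1 + Real.log (E : ℝ)) * (2 / ((K : ℝ) + 1)) := by ring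
  -- Assemble.
  rw [sum_mul_sum_divisors_filter_eq F N hs D]
  calc |∑ e ∈ Icc 1 E, ∑ k ∈ Icc 1 (N + hs), (liouville e : ℝ) * (μ k : ℝ) * T e k|
      ≤ ∑ e ∈ Icc 1 E, ∑ k ∈ Icc 1 (N + hs), |T e k| := h1
    _ ≤ ∑ e ∈ Icc 1 E, (∑ k ∈ Icc 1 K, |T e k| + ∑ k ∈ Ioc K (N + hs), |T e k|) :=
        sum_le_sum fun e _ => h2 e
    _ = ∑ e ∈ Icc 1 E, ∑ k ∈ Icc 1 K, |T e k| + ∑ e ∈ Icc 1 E, ∑ k ∈ Ioc K (N + hs), |T e k| :=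
        sum_add_distrib
    _ ≤ _ := add_le_add h3 h4

end Summit.Parity.GeneralizedHardyLittlewood.Theorems.EngineToGHL.TupleLadder
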